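/- Copyright: the b2b-balaban cell (near-miss cell 7), T⁴-continuum fan-out; row NE7b ROUND-2 swarm, seat
t4-ne7b-formalise-leaf-02 (gen 9) (row S12 «ASSEMBLY», owner sub-row S12i «APEX∕HEADLINE OVER END v3», file 2 of 3;
ruling R-OWNER-23-9, journal l.15621).  Released under the licence of the surrounding project. -/
import Summits.QuantumFields.BalabanUV.T4Continuum.Support.HistoryRealiseCellsRunPinnedT3b
import Summits.QuantumFields.BalabanUV.T4Continuum.Support.HistoryRealiseCellsRunApex
import Literature.MathematicalPhysics.QuantumFieldTheory.Balaban1983to89.T4ContinuumYM4Torus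

/-!
# Realised histories: THE COUNT ROAD AT THE APEX OVER THE END OF RECORD v3′ — per-string hybrid-NE7 data under the prefix

Summits-side support leaf of the T⁴-continuum cell (rung (B)+1 on a FINITE torus only; NOT infinite volume, NOT the
mass gap, NOT the Clay statement; NOT a proof of the spine estimate NE7b).  Row S12 ∕ node A12-I of the claim table
`t4/b2b-balaban-t4-ne7b-p1/LEAVES-NE7b.md`, owner sub-row S12i «APEX∕HEADLINE OVER END v3» (R-OWNER-23-9), file 2: the
twin of the owner's S12g file `HistoryRealiseCellsRunApex` (p219284) and of `HistoryRealiseCellsRunHeadline` v1.1's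
prefixed apex theorem (p219850) with the END swapped — END OF RECORD v2 ↦ END OF RECORD v3′
(`HistoryRealiseCellsRunMultEndD.hybridNE7_of_realisedDomainsRun_printedT3bD`, p222385, through its pinned form
`HistoryRealiseCellsRunPinnedT3b.hybridNE7_of_realisedDomainsRun_pinnedT3bD`, file 1 p222798).

WHAT.  The apex lineage's input for ALL FOUR T⁴ TARGETS is `T4ApexHybrid.HybridNE7Under D (BetaPertHyp D.βfun)`
(`= B16.EndStatementBPrinted D.C → BetaPertHyp D.βfun → ForSmallCouplings D (g₀ ↦ StringwiseHybridNE7 (D.scheme g₀))`).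
File 3 (`HistoryRealiseCellsRunHeadlineT3b`) derives it from END v3′ and ONE displayed hypothesis UNDER THE PREFIX
`T4ContinuumYM4Torus.ForSmallCouplings`: for all small-coupling tuned runs `g₀` and every loop string `os`, a
**`CountRoadWitnessT3b`** — THIS FILE's hypothesis shape: END v3′'s term data and H3 ∕ (B)-side ∕ seam binders for the
string's dressed partition functions, VERBATIM (field types = the binder types of p222385 ∕ p222798), with the observable
specialised to the string's product observable `T4GenFunBounds.prodObs (D.scheme g₀) K os` and the (α) binders sharpened
to the E1∕E2 REPRESENTATION identities in Bałaban's normalisation (`∫ e^{t·obs_K} ρ₀ dU = Σ_{τ ∈ T K} A K t τ`,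
`ρ₀ = dens K (g₀ K) 0`).  Against the owner's `CountRoadWitness` (p219284) the field diff is exactly END v2 ↦ END v3′:
{`Fc Rf Fc' Rf'`, `price price'`, `up dead_nonneg resum F_nonneg` (+ primed)} ↦ {`step_le`, `disjointJoins`,
`boxedBirths`, `FcM RfM FcM' RfM'`, `priceM priceM'` (print's currency `pshapeTH … 1 1 …` WITH the displayed discount
`exp(−Ξ)`), `upM deadM_nonneg resumM FM_nonneg` (+ primed, over the PHYSICAL member families — no placement sum)}; the
structure takes the extra parameter `hn : 0 < n` because END v3′'s binder types mention it (the letters of record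
`physV n F.L hn …`).  Theorems: **`stringHybridNE7_of_hybridNE7_repr`** (STRUCTURE-FREE form of p219284's one-string step:
`HybridNE7` for the shifted families in Bałaban's normalisation + the E1∕E2 identities ⇒
`StringHybridNE7 (D.scheme g₀) os l₀ vol (K₁ + K₂)` after rescaling each run by the constant `c_K⁻¹` of
`T4StabilitySocket.exists_const_dressedZ` — `HistoryRealiseCellsRunApex.exists_const_schemeZ`,
`HistoryHybridRescale.hybridNE7_smul` BY NAME; reusable by any future END) and **`stringHybridNE7_of_hybridNE7T3b`** (the
same read off a witness).

WHAT THE WITNESS DISPLAYS (nothing of it is discharged here): H3 (`RealisedDomainsR` reading, `step_le`, `DisjointJoins` ∕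
`BoxedBirths`, realised costs below `costT`, the discounted price sentences over `pshapeTH`, the numerator readings over
the physical member families, both runs), the E1∕E2 representation identities, the (γ) floors, site budgets, envelopes,
the (2.5) size function, NE7c's `ShellWeightBound`, NE7's `ReindexedBudget` (carrying node U4′'s sizes and the recent-scale
rates), four summable rates; and, in front of the prefix, the constants' side conditions of END v3′ (`ThresholdOK`,
`0 < μ`, κ₁∕E₀ largeness, `1 ≤ A₀`, `0 < β₀`, `F.L·β₀ ≤ 1`, `13 ≤ n₁`, the class-linear slack `C.a + θ ≤ ½γ₀A₁²` with
`θ` above row S6g′'s instance constant, `0 < E₂`, `0 ≤ E₃`, stride ∕ decay `sS θc` + three arithmetic side conditions —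
symbolic, c2; NO `Dominates`).  So the honest reading of file 3's `hybridNE7Under_of_countRoadT3b_fsc` is: **the four T⁴ targets
⇐ (B) ∧ BetaPertHyp ∧ [∀ small-coupling tuned run, ∀ string: a count-road witness over END v3′]** — the located new estimates
NE7b (H3 + price), NE7c, NE7 (and through its budget NE1′–NE5, NE9) sit INSIDE the witness as hypothesis shapes, none in
print, none a theorem of the tree; what END v3′ adds over v2 is that the slot MULTIPLICITY is no longer among them.
[folklore] composition by name; one hypothesis-shape `structure` (types as parameters, no instance attributes), no
`[cite:]` tag, nothing printed asserted, no `Prop` fact minted (c1).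

HONEST.  NE7b NOT proved; spine 0∕9.  HONEST DEPENDENCY (cell): continuum YM on T⁴ ⇐ BetaPertH ∧ nine spine estimates
(0/9 proved); BetaPertH ⇐ (D1) ∧ (D4) ∧ CAP+tail; G-an2-4 gates asym, D1 and NE2/3/4.  This file changes none of it. -/

open Finset MeasureTheory
open Literature.MathematicalPhysics.QuantumFieldTheory.Balaban1983to89
open T4PersistenceDictionary T4PersistentHistoryCount T4BankedInduction T4PrintedShapeBanking
open T4WeightBudget T4GlobalDenominator T4LiveClassFibration T4LiveStructureGas T4LiveGasToTerms T4RecordPriceSeam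
open T4PartnerMultiplicity T4IndicatorShell T4MatchingAssembly T4MatchingClosure T4MatchingClosureSocket T4Continuum
open T4StabilitySocket T4BranchingRecordsGas T4TaggedShapeBanking T4CanonicalMenus T4RenewalChains
open Summit.QuantumFields.BalabanUV.T4Continuum.PlacementBatch Summit.QuantumFields.BalabanUV.T4Continuum.PlacementSkeleton
open Summit.QuantumFields.BalabanUV.T4Continuum.CountThresholdUniform Summit.QuantumFields.BalabanUV.T4Continuum.CountThresholdExit
open Summit.QuantumFields.BalabanUV.T4Continuum.CountSeamJunction Summit.QuantumFields.BalabanUV.T4Continuum.LateMergers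
open Summit.QuantumFields.BalabanUV.T4Continuum.HistoryFlow Summit.QuantumFields.BalabanUV.T4Continuum.HistoryRegeneration
open Summit.QuantumFields.BalabanUV.T4Continuum.HistoryTables Summit.QuantumFields.BalabanUV.T4Continuum.HistoryAssemblyTrees
open Summit.QuantumFields.BalabanUV.T4Continuum.HistoryAssemblyTerms Summit.QuantumFields.BalabanUV.T4Continuum.HistoryAssemblyPedigree
open Summit.QuantumFields.BalabanUV.T4Continuum.HistoryConstants Summit.QuantumFields.BalabanUV.T4Continuum.HistoryGen
open Literature.MathematicalPhysics.QuantumFieldTheory.Balaban1983to89.B13ScaleTransfer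
open Summit.QuantumFields.BalabanUV.T4Continuum.ZoneSkeleton Summit.QuantumFields.BalabanUV.T4Continuum.HistorySocketTH
open Summit.QuantumFields.BalabanUV.T4Continuum.HistoryCaps Summit.QuantumFields.BalabanUV.T4Continuum.HistoryAssemblyPrice
open Summit.QuantumFields.BalabanUV.T4Continuum.HistoryBankingLE Summit.QuantumFields.BalabanUV.T4Continuum.HistoryExitLE
open Summit.QuantumFields.BalabanUV.T4Continuum.HistoryAssemblyTreesLE Summit.QuantumFields.BalabanUV.T4Continuum.HistoryAssemblyTermsLE
open Summit.QuantumFields.BalabanUV.T4Continuum.HistoryRealise Summit.QuantumFields.BalabanUV.T4Continuum.HistoryAssemblyRealiseLE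
open Summit.QuantumFields.BalabanUV.T4Continuum.HistoryAssemblyMult Summit.QuantumFields.BalabanUV.T4Continuum.HistoryAssemblyMultKey
open Summit.QuantumFields.BalabanUV.T4Continuum.HistoryAssemblyRealiseRun Summit.QuantumFields.BalabanUV.T4Continuum.HistoryAssemblyRealiseMult
open Summit.QuantumFields.BalabanUV.T4Continuum.HistoryZones Summit.QuantumFields.BalabanUV.T4Continuum.HistoryRealiseCells
open Summit.QuantumFields.BalabanUV.T4Continuum.HistoryRealiseCellsRun Summit.QuantumFields.BalabanUV.T4Continuum.HistoryAssemblyRealiseRunMult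

open Summit.QuantumFields.BalabanUV.T4Continuum.HistoryRealiseCellsRunMult Summit.QuantumFields.BalabanUV.T4Continuum.HistoryAssemblyMultInstance
open Summit.QuantumFields.BalabanUV.T4Continuum.HistoryJoinsPlacedMember Summit.QuantumFields.BalabanUV.T4Continuum.PlacementSkeleton
open Summit.QuantumFields.BalabanUV.T4Continuum.HistoryJoinsPlacedMult Summit.QuantumFields.BalabanUV.T4Continuum.HistoryRealiseDistinct
open Summit.QuantumFields.BalabanUV.T4Continuum.HistoryRegionTemplates Summit.QuantumFields.BalabanUV.T4Continuum.HistoryCaps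
open Summit.QuantumFields.BalabanUV.T4Continuum.HistoryZoneEvolve (cth)
open Literature.MathematicalPhysics.QuantumFieldTheory.Balaban1983to89.B16SProfile (DropCtl)

open Summit.QuantumFields.BalabanUV.T4Continuum.HistoryRealiseCellsRunMultEnd Summit.QuantumFields.BalabanUV.T4Continuum.HistoryRealiseCellsRunMultEndD
open Summit.QuantumFields.BalabanUV.T4Continuum.HistoryRealiseCellsRunPinnedT3b Summit.QuantumFields.BalabanUV.T4Continuum.HistoryHybridRescale
open Summit.QuantumFields.BalabanUV.T4Continuum.HistoryRealiseCellsRunApex (exists_const_schemeZ)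

namespace Summit.QuantumFields.BalabanUV.T4Continuum.HistoryRealiseCellsRunApexT3b

noncomputable section

section Apex

variable {F : T4Family} {G : Type*} [GaugeGroup G] [MeasurableSpace G] [HaarData G] [RegularGaugeGroup G]

/-- **A COUNT-ROAD WITNESS OVER THE END OF RECORD v3′ for the tuned run `g₀` and the loop string `os`** (HYPOTHESIS
SHAPE — data + END v3′'s displayed binders, NOTHING asserted): the term families of the string's two dressed partition
functions (run A after `K` steps, run B after `K + 1` steps, from `K₀` on, in BAŁABAN's normalisation) with the E1∕E2
representation identities; the (γ) floors, site budgets and envelopes of the (B) side; the (2.5) size function; H3 —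
pedigrees REALISED by the run's own profile with their domains, live components dated ≤ cutoff, DISJOINT partners at
every join and BOXED constituents at their birth levels (row S1c-opt's reading clauses), realised costs, the price
sentences in print's currency `pshapeTH … 1 1 …` WITH the displayed discount `exp(−Ξ)`
(`Ξ K q := 8∕C.E₂·totalCostT … + 4·partnerAges …`), the `Regeneration` numerator readings over the PHYSICAL member
families (letters of record `physV`, no placement sum); NE7c's `ShellWeightBound`; NE7's `ReindexedBudget`; four
summable rates; a positive source radius `l₀` and volume factor `vol`.  The term index type `ι` and the payload types
`α π` (with decidable equality) are PARAMETERS, and so is `hn : 0 < n` (END v3′'s binder types mention it); field names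
follow `HistoryRealiseCellsRunApex.CountRoadWitness` (p219284) where the binder is unchanged and the binders of
`HistoryRealiseCellsRunMultEndD.hybridNE7_of_realisedDomainsRun_printedT3bD` (p222385) otherwise. [folklore] -/
structure CountRoadWitnessT3b (D : FiniteEpsData F G) (C : T4PrintedShapeBanking.Consts) (O : PrintedO1s) (rr d n : ℕ)
    (hn : 0 < n) (g₀ : ℕ → ℝ) (os : List (ULoop F)) (ι α π : Type) [DecidableEq ι] [DecidableEq α] [DecidableEq π] :
    Type where
  /-- the source radius -/
  l₀ : ℝ
  /-- the volume factor of the matching remainders -/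
  vol : ℝ
  /-- the source radius is positive -/
  l₀_pos : 0 < l₀
  /-- the volume factor is positive -/
  vol_pos : 0 < vol
  /-- the threshold in the number of steps -/
  K₀ : ℕ
  /-- the term families -/
  T : ℕ → Finset ι
  /-- run A's term weights (`K` steps) -/
  A : ℕ → ℝ → ι → ℝ
  /-- run B's term weights (`K + 1` steps) -/
  A' : ℕ → ℝ → ι → ℝ
  /-- the two runs' shell parts (NE7c) -/
  (shA shB : ℕ → ℝ → ι → ℝ)
  /-- the two runs' dead weights (numerator reading) -/
  (dead dead' : ℕ → ℝ → ι → ℝ)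
  /-- the two runs' upper normalisation envelopes -/
  (nup mup : ℕ → ℝ → ℝ)
  /-- the common envelope bound -/
  Nup : ℝ
  /-- NE7 core budget data (`ReindexedBudget`) -/
  (Cc Rr CcRec RrRec : ℕ → ℝ → ι → ℝ)
  /-- NE7 core budget rates; `u s₂ r s` summable -/
  (ν u s₂ q₀ r s : ℕ → ℝ)
  /-- NE7c's shell weight budget -/
  Wsh : ℕ → ℝ
  /-- E1 REPRESENTATION (Bałaban's normalisation): run A's terms sum to the dressed integral of `ρ₀` after `K` steps -/
  reprA : ∀ K t, |t| ≤ l₀ → K₀ ≤ K →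
    ∫ U, Real.exp (t * T4GenFunBounds.prodObs (D.scheme g₀) K os U) * D.dens K (g₀ K) 0 U ∂fieldMeasure (F.P K) 0 G =
      ∑ τ ∈ T K, A K t τ
  /-- E2 REPRESENTATION: run B's terms sum to the dressed integral of `ρ₀` after `K + 1` steps -/
  reprB : ∀ K t, |t| ≤ l₀ → K₀ ≤ K →
    ∫ U, Real.exp (t * T4GenFunBounds.prodObs (D.scheme g₀) (K + 1) os U) * D.dens (K + 1) (g₀ (K + 1)) 0 U
        ∂fieldMeasure (F.P (K + 1)) 0 G = ∑ τ ∈ T K, A' K t τ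
  /-- the (γ) small-field mass floor -/
  c₀ : ℝ
  /-- the site budget -/
  n₁ : ℝ
  /-- the floor is positive -/
  c₀_pos : 0 < c₀
  /-- (γ) floor, run A -/
  floor : ∀ K, K₀ ≤ K → c₀ ≤ smallFieldMass D K (g₀ K)
  /-- (γ) floor, run B -/
  floor' : ∀ K, K₀ ≤ K → c₀ ≤ smallFieldMass D (K + 1) (g₀ (K + 1))
  /-- site budget, run A -/
  sites : ∀ K, K₀ ≤ K → ((D.C ⟨K, F.m, g₀ K⟩).numSites K : ℝ) ≤ n₁
  /-- site budget, run B -/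
  sites' : ∀ K, K₀ ≤ K → ((D.C ⟨K + 1, F.m, g₀ (K + 1)⟩).numSites (K + 1) : ℝ) ≤ n₁
  /-- the envelope bound is nonnegative -/
  Nup_nonneg : 0 ≤ Nup
  /-- envelope, run A -/
  nup_bd : ∀ K t, |t| ≤ l₀ → K₀ ≤ K → 0 ≤ nup K t ∧ nup K t ≤ Nup
  /-- envelope, run B -/
  mup_bd : ∀ K t, |t| ≤ l₀ → K₀ ≤ K → 0 ≤ mup K t ∧ mup K t ≤ Nup
  /-- the size function of (2.5) -/
  R : ℕ → ℕ → ℕ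
  /-- (2.5): `R K s` is an admissible size for the running coupling at step `s` -/
  isRj : ∀ K s, s ≤ K → B14.IsRj F.L rr ((D.C ⟨K, F.m, g₀ K⟩).flow.g s) (R K s)
  /-- sizes are at least one -/
  one_le_R : ∀ K, K₀ ≤ K → ∀ t, 1 ≤ R K t
  /-- H3: the reading map, pedigrees -/
  ped : ℕ → ι → Pedigree α π
  /-- H3: the reading map, root data of the live components -/
  cellP : ℕ → ι → π → Pt d × Finset (Pt d)
  /-- H3: the reading map, live components of each term -/
  liveC : ℕ → ι → Finset α
  /-- H3: the reading map, domains -/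
  Zd : ℕ → ι → α → Finset (Pt d)
  /-- H3: the pedigrees are REALISED by the run's own profile with their domains -/
  realised : RealisedDomainsR F.L (runProfile F.L R) n K₀ R T ped cellP liveC Zd
  /-- H3: live components are dated no later than the cutoff -/
  step_le : ∀ K, K₀ ≤ K → ∀ τ ∈ T K, ∀ c ∈ liveC K τ, (ped K τ).step c ≤ K
  /-- H3 (row S1c-opt reading clause): DISTINCT partners at every join of a live component's member -/
  disjointJoins : ∀ K, K₀ ≤ K → ∀ τ ∈ T K, ∀ c ∈ liveC K τ, DisjointJoins ((ped K τ).toPGen (cellP K τ) c)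
  /-- H3 (row S1c-opt reading clause): constituents inside the torus' fundamental box at their birth levels -/
  boxedBirths : ∀ K, K₀ ≤ K → ∀ τ ∈ T K, ∀ c ∈ liveC K τ,
    BoxedBirths n F.L K (levelOf (runProfile F.L R K) K) ((ped K τ).toPGen (cellP K τ) c)
  /-- H3: realised per-step costs, both runs -/
  (κ κ' : ℕ → (Fin d → ℕ) × Gen (Lab α π) → Gen (Lab α π) → ℕ → ℝ)
  /-- H3: realised costs below the model's booked cost, run A -/
  cost_le : ∀ K, K₀ ≤ K → ∀ τ ∈ badTerms (memOf ped liveC (cellOfR n F.L (runProfile F.L R) ped cellP)) jhalf T K, ∀ q ∈ memOf ped liveC (cellOfR n F.L (runProfile F.L R) ped cellP) K τ,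
    ∀ m ∈ life (padW (dictWT Prod.fst (R K) C.n₁) 0) q.2,
    κ K q q.2 m ≤ costT Prod.fst C K (R K) q.2 m
  /-- H3: realised costs below the model's booked cost, run B -/
  cost_le' : ∀ K, K₀ ≤ K → ∀ τ ∈ badTerms (memOf ped liveC (cellOfR n F.L (runProfile F.L R) ped cellP)) jhalf T K, ∀ q ∈ memOf ped liveC (cellOfR n F.L (runProfile F.L R) ped cellP) K τ,
    ∀ m ∈ life (padW (dictWT Prod.fst (R K) C.n₁) 0) q.2,
    κ' K q q.2 m ≤ costT Prod.fst C K (R K) q.2 m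
  /-- H3: live price ∕ dead-part resummation factors of the PHYSICAL member families, both runs -/
  (FcM RfM FcM' RfM' : ℕ → Finset ((Fin d → ℕ) × Gen PEv × Multiset (PEv × ((Fin d → ℕ) × Finset (Pt d)))) → ℝ)
  /-- H3: the per-term price sentence in print's currency WITH the displayed discount `exp(−Ξ)`, run A -/
  priceM : ∀ K t, |t| ≤ l₀ → K₀ ≤ K → ∀ τ ∈ badTerms (memOf ped liveC (cellOfR n F.L (runProfile F.L R) ped cellP)) jhalf T K,
    FcM K (kmemOf ped liveC (cellOfR n F.L (runProfile F.L R) ped cellP) (physV n F.L hn (Nat.lt_of_lt_of_le Nat.zero_lt_two (two_le_L F))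
    (fun K => tcap d (dcapOf Prod.fst T (memOf ped liveC (cellOfR n F.L (runProfile F.L R) ped cellP)) K))
    (fun K => one_le_tcap d (dcapOf Prod.fst T (memOf ped liveC (cellOfR n F.L (runProfile F.L R) ped cellP)) K)) (runProfile F.L R) ped cellP) K τ) * RfM K (kmemOf ped liveC (cellOfR n F.L (runProfile F.L R) ped cellP) (physV n F.L hn (Nat.lt_of_lt_of_le Nat.zero_lt_two (two_le_L F))
    (fun K => tcap d (dcapOf Prod.fst T (memOf ped liveC (cellOfR n F.L (runProfile F.L R) ped cellP)) K))
    (fun K => one_le_tcap d (dcapOf Prod.fst T (memOf ped liveC (cellOfR n F.L (runProfile F.L R) ped cellP)) K)) (runProfile F.L R) ped cellP) K τ) ≤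
    ∏ q ∈ memOf ped liveC (cellOfR n F.L (runProfile F.L R) ped cellP) K τ,
    pshapeTH Prod.fst O C 1 1 (R K) (D.C ⟨K, F.m, g₀ K⟩).flow.g 0 (κ K q) q.2 * Real.exp (-(8 / C.E₂ * totalCostT Prod.fst C K (R K) q.2 + 4 * (partnerAges (PEv.step ∘ Prod.fst) q.2 : ℝ)))
  /-- H3: the per-term price sentence in print's currency WITH the displayed discount `exp(−Ξ)`, run B -/
  priceM' : ∀ K t, |t| ≤ l₀ → K₀ ≤ K → ∀ τ ∈ badTerms (memOf ped liveC (cellOfR n F.L (runProfile F.L R) ped cellP)) jhalf T K,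
    FcM' K (kmemOf ped liveC (cellOfR n F.L (runProfile F.L R) ped cellP) (physV n F.L hn (Nat.lt_of_lt_of_le Nat.zero_lt_two (two_le_L F))
    (fun K => tcap d (dcapOf Prod.fst T (memOf ped liveC (cellOfR n F.L (runProfile F.L R) ped cellP)) K))
    (fun K => one_le_tcap d (dcapOf Prod.fst T (memOf ped liveC (cellOfR n F.L (runProfile F.L R) ped cellP)) K)) (runProfile F.L R) ped cellP) K τ) * RfM' K (kmemOf ped liveC (cellOfR n F.L (runProfile F.L R) ped cellP) (physV n F.L hn (Nat.lt_of_lt_of_le Nat.zero_lt_two (two_le_L F))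
    (fun K => tcap d (dcapOf Prod.fst T (memOf ped liveC (cellOfR n F.L (runProfile F.L R) ped cellP)) K))
    (fun K => one_le_tcap d (dcapOf Prod.fst T (memOf ped liveC (cellOfR n F.L (runProfile F.L R) ped cellP)) K)) (runProfile F.L R) ped cellP) K τ) ≤
    ∏ q ∈ memOf ped liveC (cellOfR n F.L (runProfile F.L R) ped cellP) K τ,
    pshapeTH Prod.fst O C 1 1 (R K) (D.C ⟨K, F.m, g₀ K⟩).flow.g 0 (κ' K q) q.2 * Real.exp (-(8 / C.E₂ * totalCostT Prod.fst C K (R K) q.2 + 4 * (partnerAges (PEv.step ∘ Prod.fst) q.2 : ℝ)))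
  /-- H3 numerator reading, run A: terms below dead weight × live price of the physical member family × envelope -/
  upM : ∀ K t, |t| ≤ l₀ → K₀ ≤ K →
    ∀ k ∈ badGMems (memOf ped liveC (cellOfR n F.L (runProfile F.L R) ped cellP)) jhalf T (kmemOf ped liveC (cellOfR n F.L (runProfile F.L R) ped cellP) (physV n F.L hn (Nat.lt_of_lt_of_le Nat.zero_lt_two (two_le_L F))
    (fun K => tcap d (dcapOf Prod.fst T (memOf ped liveC (cellOfR n F.L (runProfile F.L R) ped cellP)) K))
    (fun K => one_le_tcap d (dcapOf Prod.fst T (memOf ped liveC (cellOfR n F.L (runProfile F.L R) ped cellP)) K)) (runProfile F.L R) ped cellP)) K,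
    ∀ τ ∈ fibre (kmemOf ped liveC (cellOfR n F.L (runProfile F.L R) ped cellP) (physV n F.L hn (Nat.lt_of_lt_of_le Nat.zero_lt_two (two_le_L F))
    (fun K => tcap d (dcapOf Prod.fst T (memOf ped liveC (cellOfR n F.L (runProfile F.L R) ped cellP)) K))
    (fun K => one_le_tcap d (dcapOf Prod.fst T (memOf ped liveC (cellOfR n F.L (runProfile F.L R) ped cellP)) K)) (runProfile F.L R) ped cellP)) T K k, A K t τ ≤ dead K t τ * FcM K k * nup K t
  /-- H3 numerator reading, run A: dead weights nonnegative -/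
  deadM_nonneg : ∀ K t, |t| ≤ l₀ → K₀ ≤ K →
    ∀ k ∈ badGMems (memOf ped liveC (cellOfR n F.L (runProfile F.L R) ped cellP)) jhalf T (kmemOf ped liveC (cellOfR n F.L (runProfile F.L R) ped cellP) (physV n F.L hn (Nat.lt_of_lt_of_le Nat.zero_lt_two (two_le_L F))
    (fun K => tcap d (dcapOf Prod.fst T (memOf ped liveC (cellOfR n F.L (runProfile F.L R) ped cellP)) K))
    (fun K => one_le_tcap d (dcapOf Prod.fst T (memOf ped liveC (cellOfR n F.L (runProfile F.L R) ped cellP)) K)) (runProfile F.L R) ped cellP)) K,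
    ∀ τ ∈ fibre (kmemOf ped liveC (cellOfR n F.L (runProfile F.L R) ped cellP) (physV n F.L hn (Nat.lt_of_lt_of_le Nat.zero_lt_two (two_le_L F))
    (fun K => tcap d (dcapOf Prod.fst T (memOf ped liveC (cellOfR n F.L (runProfile F.L R) ped cellP)) K))
    (fun K => one_le_tcap d (dcapOf Prod.fst T (memOf ped liveC (cellOfR n F.L (runProfile F.L R) ped cellP)) K)) (runProfile F.L R) ped cellP)) T K k, 0 ≤ dead K t τ
  /-- H3 numerator reading, run A: the dead-part resummation over terms with EQUAL physical live data -/
  resumM : ∀ K t, |t| ≤ l₀ → K₀ ≤ K →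
    ∀ k ∈ badGMems (memOf ped liveC (cellOfR n F.L (runProfile F.L R) ped cellP)) jhalf T (kmemOf ped liveC (cellOfR n F.L (runProfile F.L R) ped cellP) (physV n F.L hn (Nat.lt_of_lt_of_le Nat.zero_lt_two (two_le_L F))
    (fun K => tcap d (dcapOf Prod.fst T (memOf ped liveC (cellOfR n F.L (runProfile F.L R) ped cellP)) K))
    (fun K => one_le_tcap d (dcapOf Prod.fst T (memOf ped liveC (cellOfR n F.L (runProfile F.L R) ped cellP)) K)) (runProfile F.L R) ped cellP)) K,
    ∑ τ ∈ fibre (kmemOf ped liveC (cellOfR n F.L (runProfile F.L R) ped cellP) (physV n F.L hn (Nat.lt_of_lt_of_le Nat.zero_lt_two (two_le_L F))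
    (fun K => tcap d (dcapOf Prod.fst T (memOf ped liveC (cellOfR n F.L (runProfile F.L R) ped cellP)) K))
    (fun K => one_le_tcap d (dcapOf Prod.fst T (memOf ped liveC (cellOfR n F.L (runProfile F.L R) ped cellP)) K)) (runProfile F.L R) ped cellP)) T K k, dead K t τ ≤ RfM K k
  /-- H3 numerator reading, run A: live prices nonnegative -/
  FM_nonneg : ∀ K t, |t| ≤ l₀ → K₀ ≤ K →
    ∀ k ∈ badGMems (memOf ped liveC (cellOfR n F.L (runProfile F.L R) ped cellP)) jhalf T (kmemOf ped liveC (cellOfR n F.L (runProfile F.L R) ped cellP) (physV n F.L hn (Nat.lt_of_lt_of_le Nat.zero_lt_two (two_le_L F))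
    (fun K => tcap d (dcapOf Prod.fst T (memOf ped liveC (cellOfR n F.L (runProfile F.L R) ped cellP)) K))
    (fun K => one_le_tcap d (dcapOf Prod.fst T (memOf ped liveC (cellOfR n F.L (runProfile F.L R) ped cellP)) K)) (runProfile F.L R) ped cellP)) K, 0 ≤ FcM K k
  /-- H3 numerator reading, run B -/
  upM' : ∀ K t, |t| ≤ l₀ → K₀ ≤ K →
    ∀ k ∈ badGMems (memOf ped liveC (cellOfR n F.L (runProfile F.L R) ped cellP)) jhalf T (kmemOf ped liveC (cellOfR n F.L (runProfile F.L R) ped cellP) (physV n F.L hn (Nat.lt_of_lt_of_le Nat.zero_lt_two (two_le_L F))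
    (fun K => tcap d (dcapOf Prod.fst T (memOf ped liveC (cellOfR n F.L (runProfile F.L R) ped cellP)) K))
    (fun K => one_le_tcap d (dcapOf Prod.fst T (memOf ped liveC (cellOfR n F.L (runProfile F.L R) ped cellP)) K)) (runProfile F.L R) ped cellP)) K,
    ∀ τ ∈ fibre (kmemOf ped liveC (cellOfR n F.L (runProfile F.L R) ped cellP) (physV n F.L hn (Nat.lt_of_lt_of_le Nat.zero_lt_two (two_le_L F))
    (fun K => tcap d (dcapOf Prod.fst T (memOf ped liveC (cellOfR n F.L (runProfile F.L R) ped cellP)) K))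
    (fun K => one_le_tcap d (dcapOf Prod.fst T (memOf ped liveC (cellOfR n F.L (runProfile F.L R) ped cellP)) K)) (runProfile F.L R) ped cellP)) T K k, A' K t τ ≤ dead' K t τ * FcM' K k * mup K t
  /-- H3 numerator reading, run B -/
  deadM'_nonneg : ∀ K t, |t| ≤ l₀ → K₀ ≤ K →
    ∀ k ∈ badGMems (memOf ped liveC (cellOfR n F.L (runProfile F.L R) ped cellP)) jhalf T (kmemOf ped liveC (cellOfR n F.L (runProfile F.L R) ped cellP) (physV n F.L hn (Nat.lt_of_lt_of_le Nat.zero_lt_two (two_le_L F))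
    (fun K => tcap d (dcapOf Prod.fst T (memOf ped liveC (cellOfR n F.L (runProfile F.L R) ped cellP)) K))
    (fun K => one_le_tcap d (dcapOf Prod.fst T (memOf ped liveC (cellOfR n F.L (runProfile F.L R) ped cellP)) K)) (runProfile F.L R) ped cellP)) K,
    ∀ τ ∈ fibre (kmemOf ped liveC (cellOfR n F.L (runProfile F.L R) ped cellP) (physV n F.L hn (Nat.lt_of_lt_of_le Nat.zero_lt_two (two_le_L F))
    (fun K => tcap d (dcapOf Prod.fst T (memOf ped liveC (cellOfR n F.L (runProfile F.L R) ped cellP)) K))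
    (fun K => one_le_tcap d (dcapOf Prod.fst T (memOf ped liveC (cellOfR n F.L (runProfile F.L R) ped cellP)) K)) (runProfile F.L R) ped cellP)) T K k, 0 ≤ dead' K t τ
  /-- H3 numerator reading, run B -/
  resumM' : ∀ K t, |t| ≤ l₀ → K₀ ≤ K →
    ∀ k ∈ badGMems (memOf ped liveC (cellOfR n F.L (runProfile F.L R) ped cellP)) jhalf T (kmemOf ped liveC (cellOfR n F.L (runProfile F.L R) ped cellP) (physV n F.L hn (Nat.lt_of_lt_of_le Nat.zero_lt_two (two_le_L F))
    (fun K => tcap d (dcapOf Prod.fst T (memOf ped liveC (cellOfR n F.L (runProfile F.L R) ped cellP)) K))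
    (fun K => one_le_tcap d (dcapOf Prod.fst T (memOf ped liveC (cellOfR n F.L (runProfile F.L R) ped cellP)) K)) (runProfile F.L R) ped cellP)) K,
    ∑ τ ∈ fibre (kmemOf ped liveC (cellOfR n F.L (runProfile F.L R) ped cellP) (physV n F.L hn (Nat.lt_of_lt_of_le Nat.zero_lt_two (two_le_L F))
    (fun K => tcap d (dcapOf Prod.fst T (memOf ped liveC (cellOfR n F.L (runProfile F.L R) ped cellP)) K))
    (fun K => one_le_tcap d (dcapOf Prod.fst T (memOf ped liveC (cellOfR n F.L (runProfile F.L R) ped cellP)) K)) (runProfile F.L R) ped cellP)) T K k, dead' K t τ ≤ RfM' K k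
  /-- H3 numerator reading, run B -/
  FM'_nonneg : ∀ K t, |t| ≤ l₀ → K₀ ≤ K →
    ∀ k ∈ badGMems (memOf ped liveC (cellOfR n F.L (runProfile F.L R) ped cellP)) jhalf T (kmemOf ped liveC (cellOfR n F.L (runProfile F.L R) ped cellP) (physV n F.L hn (Nat.lt_of_lt_of_le Nat.zero_lt_two (two_le_L F))
    (fun K => tcap d (dcapOf Prod.fst T (memOf ped liveC (cellOfR n F.L (runProfile F.L R) ped cellP)) K))
    (fun K => one_le_tcap d (dcapOf Prod.fst T (memOf ped liveC (cellOfR n F.L (runProfile F.L R) ped cellP)) K)) (runProfile F.L R) ped cellP)) K, 0 ≤ FcM' K k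
  /-- NE7c: the indicator shells' relative weight bound -/
  shell : ShellWeightBound l₀ T A A' shA shB Wsh
  /-- NE7: the core budget on the hybrid cores over the bad classes -/
  budget : ReindexedBudget l₀ vol T (fun K t τ => A K t τ - shA K t τ) (fun K t τ => A' K t τ - shB K t τ)
    (badOfClass (bstrOf Prod.fst (memOf ped liveC (cellOfR n F.L (runProfile F.L R) ped cellP))) T
    (fun K _ => badClasses Prod.fst (memOf ped liveC (cellOfR n F.L (runProfile F.L R) ped cellP)) jhalf T K)) Cc Rr CcRec RrRec ν u s₂ q₀ r s
  /-- summable rates -/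
  sum_r : Summable r
  /-- summable rates -/
  sum_u : Summable u
  /-- summable rates -/
  sum_s : Summable s
  /-- summable rates -/
  sum_s₂ : Summable s₂

omit [RegularGaugeGroup G] in
/-- **ONE STRING, STRUCTURE-FREE: `HybridNE7` IN BAŁABAN's NORMALISATION + THE E1∕E2 IDENTITIES ⇒ THE APEX'S PER-STRING
DATUM** (the content of p219284's `stringHybridNE7_of_hybridNE7`, stated over the term data alone so that every END can use
it): `HybridNE7` for the families shifted to `K₁ + (K₂ + ·)` with `K₀ ≤ K₁`, together with the representation identities
`∫ e^{t·obs_K} ρ₀ dU = Σ_{T K} A K t` (run A) ∕ `… = Σ_{T K} A' K t` (run B, `K + 1` steps), gives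
`StringHybridNE7 (D.scheme g₀) os l₀ vol (K₁ + K₂)` after rescaling run A by `c_K⁻¹` and run B by `c_{K+1}⁻¹`
(`HistoryRealiseCellsRunApex.exists_const_schemeZ`: Bałaban's `ρ₀ = c·e^{−A∕g₀²}` versus the Wilson-normalised `schemeZ`;
`HistoryHybridRescale.hybridNE7_smul`). [folklore] -/
theorem stringHybridNE7_of_hybridNE7_repr (D : FiniteEpsData F G) {g₀ : ℕ → ℝ} {os : List (ULoop F)} {ι : Type}
    [DecidableEq ι] {l₀ vol : ℝ} {K₀ : ℕ} {T : ℕ → Finset ι} {A A' shA shB : ℕ → ℝ → ι → ℝ} {Wsh : ℕ → ℝ}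
    (reprA : ∀ K t, |t| ≤ l₀ → K₀ ≤ K →
      ∫ U, Real.exp (t * T4GenFunBounds.prodObs (D.scheme g₀) K os U) * D.dens K (g₀ K) 0 U ∂fieldMeasure (F.P K) 0 G =
        ∑ τ ∈ T K, A K t τ)
    (reprB : ∀ K t, |t| ≤ l₀ → K₀ ≤ K →
      ∫ U, Real.exp (t * T4GenFunBounds.prodObs (D.scheme g₀) (K + 1) os U) * D.dens (K + 1) (g₀ (K + 1)) 0 U
          ∂fieldMeasure (F.P (K + 1)) 0 G = ∑ τ ∈ T K, A' K t τ)
    {Bad : ℕ → ℝ → Finset ι} {W δ : ℕ → ℝ} {K₁ K₂ : ℕ} (hK : K₀ ≤ K₁)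
    (hH : HybridNE7 l₀ vol (fun K => T (K₁ + (K₂ + K))) (fun K => A (K₁ + (K₂ + K)))
      (fun K => A' (K₁ + (K₂ + K))) Bad W (fun K => shA (K₁ + (K₂ + K))) (fun K => shB (K₁ + (K₂ + K)))
      (fun K => Wsh (K₁ + (K₂ + K))) δ) :
    StringHybridNE7 (D.scheme g₀) os l₀ vol (K₁ + K₂) := by
  -- the two runs' normalisation constants, cutoff by cutoff
  have hcA : ∀ K, ∃ c : ℝ, 0 < c ∧ ∀ t : ℝ,
      ∫ U, Real.exp (t * T4GenFunBounds.prodObs (D.scheme g₀) K os U) * D.dens K (g₀ K) 0 U ∂fieldMeasure (F.P K) 0 G =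
        c * T4GenFunBounds.schemeZ (D.scheme g₀) os K t := fun K => exists_const_schemeZ D g₀ os K
  choose c hc hcZ using hcA
  have hzp : ∀ K, 0 < (c (K₁ + (K₂ + K)))⁻¹ := fun K => inv_pos.2 (hc _)
  have hz'p : ∀ K, 0 < (c (K₁ + (K₂ + K) + 1))⁻¹ := fun K => inv_pos.2 (hc _)
  have hH' := hybridNE7_smul (z := fun K => (c (K₁ + (K₂ + K)))⁻¹) (z' := fun K => (c (K₁ + (K₂ + K) + 1))⁻¹)
    hzp hz'p hH
  refine ⟨ι, inferInstance, fun K => T (K₁ + (K₂ + K)), fun K t τ => (c (K₁ + (K₂ + K)))⁻¹ * A (K₁ + (K₂ + K)) t τ,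
    fun K t τ => (c (K₁ + (K₂ + K) + 1))⁻¹ * A' (K₁ + (K₂ + K)) t τ,
    fun K t τ => (c (K₁ + (K₂ + K)))⁻¹ * shA (K₁ + (K₂ + K)) t τ,
    fun K t τ => (c (K₁ + (K₂ + K) + 1))⁻¹ * shB (K₁ + (K₂ + K)) t τ, Bad, W, fun K => Wsh (K₁ + (K₂ + K)), δ, hH',
    ?_, ?_⟩
  · intro K t ht
    have hKK : K₀ ≤ K₁ + (K₂ + K) := hK.trans (Nat.le_add_right _ _)
    have h1 := reprA (K₁ + (K₂ + K)) t ht hKK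
    have h2 := hcZ (K₁ + (K₂ + K)) t
    have hcp := hc (K₁ + (K₂ + K))
    rw [show K₁ + K₂ + K = K₁ + (K₂ + K) from Nat.add_assoc _ _ _, ← mul_sum, ← h1, h2, ← mul_assoc,
      inv_mul_cancel₀ hcp.ne', one_mul]
  · intro K t ht
    have hKK : K₀ ≤ K₁ + (K₂ + K) := hK.trans (Nat.le_add_right _ _)
    have h1 := reprB (K₁ + (K₂ + K)) t ht hKK
    have h2 := hcZ (K₁ + (K₂ + K) + 1) t
    have hcp := hc (K₁ + (K₂ + K) + 1)
    rw [show K₁ + K₂ + K + 1 = K₁ + (K₂ + K) + 1 by omega, ← mul_sum, ← h1, h2, ← mul_assoc,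
      inv_mul_cancel₀ hcp.ne', one_mul]

omit [RegularGaugeGroup G] in
/-- **ONE STRING: END v3′ ⇒ THE APEX'S PER-STRING HYBRID-NE7 DATUM** — `stringHybridNE7_of_hybridNE7_repr` with the data and
the E1∕E2 identities read off a `CountRoadWitnessT3b`. [folklore] -/
theorem stringHybridNE7_of_hybridNE7T3b (D : FiniteEpsData F G) {C : T4PrintedShapeBanking.Consts} {O : PrintedO1s}
    {rr d n : ℕ} {hn : 0 < n} {g₀ : ℕ → ℝ} {os : List (ULoop F)} {ι α π : Type} [DecidableEq ι] [DecidableEq α]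
    [DecidableEq π] (X : CountRoadWitnessT3b D C O rr d n hn g₀ os ι α π) {Bad : ℕ → ℝ → Finset ι} {W δ : ℕ → ℝ}
    {K₁ K₂ : ℕ} (hK : X.K₀ ≤ K₁)
    (hH : HybridNE7 X.l₀ X.vol (fun K => X.T (K₁ + (K₂ + K))) (fun K => X.A (K₁ + (K₂ + K)))
      (fun K => X.A' (K₁ + (K₂ + K))) Bad W (fun K => X.shA (K₁ + (K₂ + K))) (fun K => X.shB (K₁ + (K₂ + K)))
      (fun K => X.Wsh (K₁ + (K₂ + K))) δ) :
    StringHybridNE7 (D.scheme g₀) os X.l₀ X.vol (K₁ + K₂) :=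
  stringHybridNE7_of_hybridNE7_repr D X.reprA X.reprB hK hH

end Apex

end

end Summit.QuantumFields.BalabanUV.T4Continuum.HistoryRealiseCellsRunApexT3b
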